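import Summits.QuantumFields.YangMills.Theorems.BalabanUVNodesN08AtRecord13CoPH
import Summits.QuantumFields.YangMills.Theorems.BalabanUVNodesN08AtRecord13Family
import Literature.MathematicalPhysics.QuantumFieldTheory.Balaban1983to89.Node00.Record13ResidualsR

/-!
# BalabanUVNodes ∕ N08 ON THE H-LIFTS OF THE STAGE-13 WITNESS FAMILIES — v1.7 `CoPH` EDITION OF RECORD 13 (director-ym LINE №183 RULING H1ʰ ∕ №186 (α) ∕ №187; FINDING №9 = node00-def-T LOCATED-9 «the v1.6 residual 𝐓-weight slot `Stage13RParams.Zr p`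
is run-indexed but HISTORY-BLIND, while print's ζ(Ω^c_{k+1}) ([Balaban1988Convergent] p.267 L15–20, (3.23) p.270) reads the term's whole history (Ω_j, Λ_j)»): def-T FILE 27 `Node00/Record13CoPH`
(p537939 ✓ 2668afee4a5b: `structure Stage13HParams extends Stage13RParams` + history-indexed fields `Zh p n Ω Λ : TkResidualW F N (FluctV N) p.K` (level-indexed, read AT THE WHOLE HISTORY `θ.zhAt p s = θ.Zh p n s.Ω s.Λ`)
and `Phih` (history-indexed smearing functions of the residual §2 data, C2 fold №187), guard `ZhUnity`, weights `WtOfRecord₁₃H θ p s`, provisos `Stage13HParams.Provisos₁₃CoPH` (Core rows +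
`zhLaws ∕ zhLocal`), view `toStage5₁₃CoPH`, datum `datumOfRecord₁₃CoPH`, record `IsRecordOfRecord₁₃CCoPH` + faces; THE DOOR `Stage13HParams.ofHistoryBlind θ := ⟨θ, fun p _ _ _ => θ.Zr p, fun p _ _ _ => (θ.Rz p.K).phi⟩`
+ `rfl` ∕ `Iff.rfl` faces + dot-forms `Stage13RParams.ZrUnity.ofHistoryBlind ∕ ….Provisos₁₃(Sep)CoPR.ofHistoryBlind`) and FILE 28T `Node00/Record13SepCoPH` (p539169 ✓ df011462f50f: `Provisos₁₃SepCoPH`, `datumOfRecord₁₃SepCoPH`,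
`IsRecordOfRecord₁₃CSepCoPH` + `.toCoPH`); dag-n10-d's H carrier leaves `Node00/Record13CarriersCoPH` (p539476 ✓ 944d848ee41f: §0 THE H-PIN ALGEBRA `Stage13HParams.onBase ∕ rebindX ∕ pin<G>` (structure updates
keeping `Zh ∕ Phih`), `toStage5₁₃CoPH_rebindX ∕ _pin<G>`, `Provisos₁₃CoPH.rebindX ∕ .pin<G>`, `datumOfRecord₁₃CoPH_rebindX ∕ _pin<G>`, `isRecordOfRecord₁₃CCoPH_rebindX ∕ _pinB10_of_eq`, `exists_world_…_rebindX`,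
`guard_rebindX_iff`, H views `view₁₃CoPHB10YZW ∕ …B8B10YZW` + `_eq` + `_leaves`, §6 door-commute faces) and `…/Record13CarriersSepCoPH` (dag-n10-d W2, filed after W1 ✓: `Provisos₁₃SepCoPH.pin<G>`, `datumOfRecord₁₃SepCoPH_pin<G>`,
`isRecordOfRecord₁₃CSepCoPH_pinB10_of_eq`).  Token map T₇ (plan IMPACT-183 + AMENDMENT (α), def-T KEYMAP v1.7, dag-lead WORDS): «the v1.6 names with `CoPR ↦ CoPH`, binders `Stage13RParams ↦ Stage13HParams`, `ZrUnity ↦ ZhUnity`, rows `zrLaws ∕ zrLocal ↦ zhLaws ∕ zhLocal`, `WtOfRecord₁₃R θ p ↦ (s ↦ WtOfRecord₁₃H θ p s)`».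
# THIS FILE = the T₇ image of `BalabanUVNodesN08AtRecord13CoPRFamily` (p533490): N08's share of a C-keyed ₁₃ nodes-∃ WITNESSED AT THE H-LIFTS `⟨⟨θ₀, Zr⟩, Zh, Phih⟩` of node00-def-K0a's
# all-numerics family `θ₀ = theta13LiveOfNumerics F N n ε₂₉ …` and two-letter family `θ₀ = theta13LiveOfFamily₂ …` (θ-level makers, background-free), where it costs the provisos
# there + `PrintedUV3V N F.L`; and THE SUPPLIER CURRENCIES OF THAT SLOT AT THE FAMILY'S OWN BLOCK SIZE `F.L` (Track A, DAG node N08 [Balaban1985UV3] CMP **102** (1985) 255, Thm 1 p. 257 (compact reading) + Thm 2 p. 272; R134 fan-out seat `pub-ymgap-dag-n08-c` g17, strategy s2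
«knit at the record of record», trigger (t31) = FINDING №9 ∕ №174 (3) «pens port their OWN files»; 2026-08-27)

WHY THIS FILE.  p533490 is keyed on `Stage13RParams ∕ Provisos₁₃CoPR ∕ datumOfRecord₁₃CoPR ∕ IsRecordOfRecord₁₃CCoPR`; at v1.7 the parameter type changes again and K0a's ⁷ witnesses are
door images `Stage13HParams.ofHistoryBlind (ofCured θ₀)` of its v1.5 makers (dag-n10-d l.20236), so the witness-line theorems are re-typed here over this seat's H storey
`BalabanUVNodesN08AtRecord13CoPH` (§2 `exists_world₁₃CCoPH_b10_main_of_slot`, §1 `b10_main_iff_of_up_pinB10`) AT THE GENERIC H-LIFT — name-free in K0a's makers (any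
`⟨⟨θ₀, Zr₀⟩, Zh₀, Phih₀⟩`, in particular `ofHistoryBlind ⟨θ₀, Zr₀⟩`, is served by `exact`).  CITED, not re-declared: K0a's `admissible_ ∕ slotsNondegenerate₁₃_…_of_hasResiduals` faces of
`θ₀` (through the base), p494431's `rfl` faces (`theta13LiveOfNumerics_L ∕ _γ`, `theta13LiveOfFamily₂_L`), dag-n08-a ∕ n08-e's supplier faces.
HONEST DEPARTURES FROM A PURE TOKEN IMAGE (generator `tools/coph_n08_gen.py`; every other statement SHAPE verbatim under T₇, proofs re-checked):
(i) the 𝐑-bundle `WOfRecord₁₃` (12a; reads no 𝐓-slot, NOT re-issued) is fed the base `θ.toStage13Params`, as at ⁶; (ii′) every WITNESS-LINE theorem is stated at the H-LIFT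
`⟨⟨θ₀, Zr⟩, Zh, Phih⟩ : Stage13HParams F N` of node00-def-K0a's v1.5 maker `θ₀` (`theta13LiveOfRecord ∕ theta13LiveOfNumerics … ∕ theta13LiveOfFamily₂ …`, θ-level, background-free)
by an ARBITRARY run-indexed residual family `Zr` AND ARBITRARY history-indexed fields `Zh ∕ Phih` (FILE 27's field tuple; so K0a's history-blind ⁷ witnesses `ofHistoryBlind ⟨θ₀, Zr₀⟩`
AND any future VALUE pin of `Zh` instantiate them by `exact`); admissibility and `SlotsNondegenerate₁₃` of the lift ARE K0a's faces of `θ₀` through the base (definitional), while the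
guard half `ZhUnity` is DISPLAYED as `hZ` in the `N = 2` forms; (iii) the two ⁶ forms `…_at_ZrOfRecord₁₃` become `…_at_ofHistoryBlind_ZrOfRecord₁₃`, stated AT THE DOOR
`Stage13HParams.ofHistoryBlind F 2 ⟨θL, ZrOfRecord₁₃ F 2 θL⟩` (= `ofHistoryBlind (Stage13RParams.ofCured F 2 θL)` of K0a's `Record13SepCoPRInhabitedOfSepCoP` §2, by `rfl`): there the v1.7
guard `ZhUnity` IS the cured R-lift's `ZrUnity` through def-T's `Stage13RParams.ZrUnity.ofHistoryBlind`, hence HYPOTHESIS-FREE by FILE 17 `finsum_ζ0_ZrOfRecord₁₃` (every generation, every run).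

WHAT THIS FILE PROVES (kernel bookkeeping BY NAME; 0 `def`, 0 `sorry`).
* §1 AT `⟨⟨θ₁₃(n, ε₂₉), Zr⟩, Zh, Phih⟩`: `exists_world₁₃CCoPH_b10_main_at_theta13LiveOfNumerics (Zr Zh Phih) (hn : n.Pos) (hε' : 0 < ε₂₉) (hP : Provisos₁₃CoPH) (hUV : PrintedUV3V N F.L)` — a
  world of the lift's datum (`w.γ = n.γ`, `w.L = F.L`) bound over the [B10]-pinned H view, a ₁₃CCoPH record carrying N08 at every run; `b10_main_iff_at_theta13LiveOfNumerics` (exact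
  cost «in-edges → `PrintedUV3V N F.L`»); at `N = 2`: `exists_guarded_record₁₃CCoPH_b10_main_of_theta13Numerics_provisosCoPH_two (Zr Zh Phih) … (hZ) (hUV)` and THE DOOR FORM
  `…_two_at_ofHistoryBlind_ZrOfRecord₁₃` at `Stage13HParams.ofHistoryBlind F 2 ⟨θL, ZrOfRecord₁₃ F 2 θL⟩`, guard HYPOTHESIS-FREE (departure (iii)).
* §2 AT `⟨⟨θ₁₃(ε₀, ε₂₉), Zr⟩, Zh, Phih⟩`: `exists_world₁₃CCoPH_b10_main_at_theta13LiveOfFamily₂ (hε : 0 < ε₀) (hε')`, `exists_guarded_record₁₃CCoPH_b10_main_of_theta13Family₂_provisosCoPH_two`.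
* §3 SUPPLIER CURRENCIES AT `L := F.L` into §1 (generic `N`): `…_at_theta13LiveOfNumerics_of_uniformLeafSystemsG ∕ _of_thm1Compact_perRun ∕ _of_perRunUniformO1` — (u) uniform leaf
  systems (dag-n08-a `printedUV3V_of_uniformLeafSystems_at`), (r) «relative to (5)» (dag-n08-e `printedUV3V_of_thm1Compact_perRun`), (o) per-run data with a run-uniform O(1)
  (dag-n08-a `printedUV3V_of_perRunUniformO1`); §3b the same three INTO N08's conjunct at the lift, `N = 2`, provisos opaque, `hZ` displayed:
  `exists_guarded_record₁₃CCoPH_b10_main_of_theta13Numerics_provisosCoPH_two_of_uniformLeafSystemsG ∕ _of_thm1Compact_perRun ∕ _of_perRunUniformO1`.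
HONEST FRAMING.  Count-neutral re-keying of a LANDED storey to the re-issued record (new file; p533490 stays as the ⁶ sibling); nothing of Bałaban's asserted: `n.Pos`, `0 < ε₂₉`
(`0 < ε₀`), `Provisos₁₃CoPH`, `hZ`, and `PrintedUV3V` or its supplier data are DISPLAYED hypotheses on every theorem; `Node00.PrintedUV3V` is TYPED, NOT PROVED — an inhabitant (the
[B10] cluster expansion at print's run objects) remains THE object gap of N08; a re-key is not progress; K0 ∕ K1 neither proved nor assumed; N08 NOT discharged; one finite four-torus
per run at fixed `ε`, [B10]'s d = 3 lattices inside the record; nothing continuum ∕ ℝ⁴ ∕ OS ∕ mass gap ∕ Clay.  0 `sorry`, 0 `def`, standard axioms.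
Sources: [Balaban1985UV3] Thm 1 p.257, Thm 2 p.272, Sect. D pp.272–275; [Balaban1989LargeFieldII] Thm 1 + (0.1) pp.355–356; [Balaban1988Convergent] Thm 1 p.262, (1.11) p.248,
(2.18) p.257, p.267, (3.16)–(3.23) pp.268–270; [Balaban1987RG1] (0.1) p.251, (0.21) p.256, (2.9) p.266; [Balaban1989LargeFieldI] (0.3)–(0.4) p.176; [Balaban1985Averaging] (10) p.19.
-/

noncomputable section

namespace Summit.QuantumFields.YangMills.BalabanUVNodes.N08AtRecord13CoPHFamily

open Literature.MathematicalPhysics.QuantumFieldTheory.Balaban1983to89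
open Literature.MathematicalPhysics.QuantumFieldTheory.Balaban1983to89.T4Continuum (T4Family FiniteEpsData)
open Literature.MathematicalPhysics.QuantumFieldTheory.Balaban1983to89.DagBinding (WorldP leavesP)
open Literature.MathematicalPhysics.QuantumFieldTheory.Balaban1983to89.Node00
open Literature.MathematicalPhysics.QuantumFieldTheory.Balaban1983to89.B10RunsOfRecord (Consts UniformLeafSystemsG runObjects₀T Backgrounds runsAtG)
open Literature.MathematicalPhysics.QuantumFieldTheory.Balaban1985CMP102
open Literature.MathematicalPhysics.QuantumFieldTheory.Balaban1985CMP102.Setting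
open Literature.MathematicalPhysics.QuantumFieldTheory.Balaban1985CMP102.Theorems (Family)
open Summit.QuantumFields.YangMills.BalabanUVNodes.N08AtRecord13CoPH
open Summit.QuantumFields.YangMills.BalabanUVNodes.N08AtRecord9CB10 (printedUV3V_of_uniformLeafSystems_at)
open Summit.QuantumFields.YangMills.Theorems.BalabanUVNodesN08RelativeTo5 (printedUV3V_of_thm1Compact_perRun)
open Summit.QuantumFields.YangMills.Theorems.BalabanUVNodesN08UniformO1 (printedUV3V_of_perRunUniformO1)
open scoped Matrix.Norms.L2Operator

/-! ## §1 ON THE ALL-NUMERICS STAGE-13 WITNESS FAMILY `θ₁₃(n, ε₂₉) = theta13LiveOfNumerics F N n ε₂₉ (zeta316OfRecord F N n.ν n.τ9.M n.A₁) (RzOfRecord F N) (ZtOfRecord F N)`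
(K0b's residuals of record; block size `F.L`, window `n.γ`) — N08's share costs `PrintedUV3V N F.L` -/

section Numerics
variable (F : T4Family) (N : ℕ) [NeZero N] (Zr : (p : B12.RunParams) → TkResidualW F N (FluctV N) p.K)
  (Zh : (p : B12.RunParams) → ℕ → (ℕ → Set (Site (F.P p.K) 0)) → (ℕ → Set (Site (F.P p.K) 0)) → TkResidualW F N (FluctV N) p.K)
  (Phih : (p : B12.RunParams) → ℕ → (ℕ → Set (Site (F.P p.K) 0)) → (ℕ → Set (Site (F.P p.K) 0)) → (ℕ → Plaq (F.P p.K) 0 → ℝ)) {n : Stage12Numerics} {ε₂₉ : ℝ}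

/-- **N08's SHARE OF THE STAGE-13 NODES STUB AT ANY MEMBER `θ₁₃(n, ε₂₉)` COSTS THE SINGLE PROP `PrintedUV3V N F.L`** (plus the Core provisos `hP` at the member, HYPOTHESIS,
and the two displayed signs `n.Pos`, `0 < ε₂₉` under which K0a's `admissible_theta13LiveOfNumerics` gives admissibility): a world of the member's datum of record (`w.γ = n.γ`,
`w.L = F.L`), bound over the [B10]-pinned CoPH view of the member, that IS a ₁₃CCoPH record and carries N08 at every run (the CoPH storey's §2 `exists_world₁₃CCoPH_b10_main_of_slot`).
At `N = 2`: [Balaban1985UV3] Thm 1-compact ∧ Thm 2 with their printed ∃-prefix for SU(2) at the family's block size `F.L`, at some version of print's transformations.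
[cite: Balaban1985UV3, Thm 1 p.257, Thm 2 p.272; Balaban1989LargeFieldII, Thm 1 + (0.1) pp.355–356; Balaban1987RG1, (0.21) p.256, (2.9) p.266 (bookkeeping)] -/
theorem exists_world₁₃CCoPH_b10_main_at_theta13LiveOfNumerics (hn : n.Pos) (hε' : 0 < ε₂₉)
    (hP : (⟨⟨theta13LiveOfNumerics F N n ε₂₉ (zeta316OfRecord F N n.ν n.τ9.M n.A₁) (RzOfRecord F N) (ZtOfRecord F N), Zr⟩, Zh, Phih⟩ : Stage13HParams F N).Provisos₁₃CoPH F N)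
    (hUV : PrintedUV3V N F.L) :
    ∃ w : WorldP,
      IsRecordOfRecord₁₃CCoPH F N
          (datumOfRecord₁₃CoPH F N (⟨⟨theta13LiveOfNumerics F N n ε₂₉ (zeta316OfRecord F N n.ν n.τ9.M n.A₁) (RzOfRecord F N) (ZtOfRecord F N), Zr⟩, Zh, Phih⟩ : Stage13HParams F N) hP) w ∧
        w.γ = n.γ ∧ w.L = (F.L : ℝ) ∧
        (∀ P, w.up P = upOfRecord₅C F N
          (((⟨⟨theta13LiveOfNumerics F N n ε₂₉ (zeta316OfRecord F N n.ν n.τ9.M n.A₁) (RzOfRecord F N) (ZtOfRecord F N), Zr⟩, Zh, Phih⟩ : Stage13HParams F N).pinB10 F N).toStage5₁₃CoPH F N) P) ∧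
        ∀ P : B12.RunParams, Dag.B10_main (leavesP w P) :=
  have hθ := admissible_theta13LiveOfNumerics F N (zeta316OfRecord F N n.ν n.τ9.M n.A₁) (RzOfRecord F N) (ZtOfRecord F N) hn hε'
  exists_world₁₃CCoPH_b10_main_of_slot _ hP hθ (γw := n.γ) ⟨hθ.toStage9.gamma_pos, le_rfl⟩ hUV

/-- **EXACT COST AT THE MEMBER**: at any world bound over the [B10]-pinned view of `θ₁₃(n, ε₂₉)`, N08 at a run ⟺ «in-edge leaves ⟹ `PrintedUV3V N F.L`». [cite: Balaban1985UV3, Thm 1 p.257, Thm 2 p.272] -/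
theorem b10_main_iff_at_theta13LiveOfNumerics {w : WorldP}
    (hup : ∀ P, w.up P = upOfRecord₅C F N
      (((⟨⟨theta13LiveOfNumerics F N n ε₂₉ (zeta316OfRecord F N n.ν n.τ9.M n.A₁) (RzOfRecord F N) (ZtOfRecord F N), Zr⟩, Zh, Phih⟩ : Stage13HParams F N).pinB10 F N).toStage5₁₃CoPH F N) P)
    (P : B12.RunParams) :
    Dag.B10_main (leavesP w P) ↔
      ((leavesP w P).b5 → (leavesP w P).b6 → (leavesP w P).b7 → (leavesP w P).b8 → (leavesP w P).b9 → (leavesP w P).b11 → PrintedUV3V N F.L) :=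
  b10_main_iff_of_up_pinB10 _ hup P

/-- **N08's CONJUNCT OF THE STAGE-13 NODES-∃, WITNESSED AT THE MEMBER `θL F n ε₂₉`, `N = 2`** — from the Core provisos at the member (`hP : Provisos₁₃CoPH`, HYPOTHESIS), the signs
`n.Pos`, `0 < ε₂₉`, and `PrintedUV3V 2 F.L`: the guard (the DISPLAYED `hZ : ZhUnity` of the H-lift ∕ K0a's HYPOTHESIS-FREE `slotsNondegenerate₁₃_theta13LiveOfNumerics_of_hasResiduals`) and admissibility are K0a's
theorems BY NAME.  NOT the stub, NOT a discharge. [cite: Balaban1985UV3, Thm 1 p.257, Thm 2 p.272; Balaban1988Convergent, Thm 1 p.262, (3.16)–(3.22) pp.268–269; Balaban1989LargeFieldI, (0.3)–(0.4) p.176 (bookkeeping)] -/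
theorem exists_guarded_record₁₃CCoPH_b10_main_of_theta13Numerics_provisosCoPH_two (F : T4Family) (Zr : (p : B12.RunParams) → TkResidualW F 2 (FluctV 2) p.K)
    (Zh : (p : B12.RunParams) → ℕ → (ℕ → Set (Site (F.P p.K) 0)) → (ℕ → Set (Site (F.P p.K) 0)) → TkResidualW F 2 (FluctV 2) p.K)
    (Phih : (p : B12.RunParams) → ℕ → (ℕ → Set (Site (F.P p.K) 0)) → (ℕ → Set (Site (F.P p.K) 0)) → (ℕ → Plaq (F.P p.K) 0 → ℝ)) {n : Stage12Numerics} {ε₂₉ : ℝ} (hn : n.Pos) (hε' : 0 < ε₂₉)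
    (hP : (⟨⟨theta13LiveOfNumerics F 2 n ε₂₉ (zeta316OfRecord F 2 n.ν n.τ9.M n.A₁) (RzOfRecord F 2) (ZtOfRecord F 2), Zr⟩, Zh, Phih⟩ : Stage13HParams F 2).Provisos₁₃CoPH F 2)
    (hZ : (⟨⟨theta13LiveOfNumerics F 2 n ε₂₉ (zeta316OfRecord F 2 n.ν n.τ9.M n.A₁) (RzOfRecord F 2) (ZtOfRecord F 2), Zr⟩, Zh, Phih⟩ : Stage13HParams F 2).ZhUnity F 2) (hUV : PrintedUV3V 2 F.L) :
    ∃ (θ : Stage13HParams F 2) (h : θ.Provisos₁₃CoPH F 2) (w : WorldP), (θ.ZhUnity F 2 ∧ θ.SlotsNondegenerate₁₃ F 2) ∧ θ.Admissible F 2 ∧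
      IsRecordOfRecord₁₃CCoPH F 2 (datumOfRecord₁₃CoPH F 2 θ h) w ∧ ∀ P : B12.RunParams, Dag.B10_main (leavesP w P) := by
  obtain ⟨w, hR, -, -, -, hN⟩ := exists_world₁₃CCoPH_b10_main_at_theta13LiveOfNumerics F 2 Zr Zh Phih hn hε' hP hUV
  exact ⟨_, hP, w, ⟨hZ, slotsNondegenerate₁₃_theta13LiveOfNumerics_of_hasResiduals F 2 n ε₂₉⟩,
    admissible_theta13LiveOfNumerics F 2 _ _ _ hn hε', hR, hN⟩

/-- **THE SAME AT THE DOOR IMAGE OF node00-def-K0a's CURED PIN OF RECORD, `Stage13HParams.ofHistoryBlind F 2 ⟨θL, ZrOfRecord₁₃ F 2 θL⟩`** (= `ofHistoryBlind (Stage13RParams.ofCured F 2 θL)`,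
`rfl`; FILE 17: dag-n11-d's diagonal cure made a definition; FILE 27's door = a v1.6 parameter read as a v1.7 one with history-constant slot — the shape of K0a's ⁷ witnesses): there the
v1.7 guard `ZhUnity` IS the cured R-lift's `ZrUnity` (def-T's `Stage13RParams.ZrUnity.ofHistoryBlind`) = K0a's `finsum_ζ0_ZrOfRecord₁₃` — HYPOTHESIS-FREE; so N08's conjunct there costs EXACTLY
what it cost at ⁵ ∕ ⁶ — the provisos there (HYPOTHESIS, opaque), the signs, and `PrintedUV3V 2 F.L`.  NOT the stub, NOT a discharge.
[cite: Balaban1985UV3, Thm 1 p.257, Thm 2 p.272; Balaban1988Convergent, (1.11) p.248, (3.16)–(3.22) pp.268–269; Balaban1989LargeFieldI, (0.3)–(0.4) p.176 (bookkeeping)] -/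
theorem exists_guarded_record₁₃CCoPH_b10_main_of_theta13Numerics_provisosCoPH_two_at_ofHistoryBlind_ZrOfRecord₁₃ (F : T4Family) {n : Stage12Numerics} {ε₂₉ : ℝ} (hn : n.Pos)
    (hε' : 0 < ε₂₉)
    (hP : (Stage13HParams.ofHistoryBlind F 2
      (⟨theta13LiveOfNumerics F 2 n ε₂₉ (zeta316OfRecord F 2 n.ν n.τ9.M n.A₁) (RzOfRecord F 2) (ZtOfRecord F 2),
        ZrOfRecord₁₃ F 2 (theta13LiveOfNumerics F 2 n ε₂₉ (zeta316OfRecord F 2 n.ν n.τ9.M n.A₁) (RzOfRecord F 2) (ZtOfRecord F 2))⟩ : Stage13RParams F 2)).Provisos₁₃CoPH F 2)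
    (hUV : PrintedUV3V 2 F.L) :
    ∃ (θ : Stage13HParams F 2) (h : θ.Provisos₁₃CoPH F 2) (w : WorldP), (θ.ZhUnity F 2 ∧ θ.SlotsNondegenerate₁₃ F 2) ∧ θ.Admissible F 2 ∧
      IsRecordOfRecord₁₃CCoPH F 2 (datumOfRecord₁₃CoPH F 2 θ h) w ∧ ∀ P : B12.RunParams, Dag.B10_main (leavesP w P) :=
  exists_guarded_record₁₃CCoPH_b10_main_of_theta13Numerics_provisosCoPH_two F _ _ _ hn hε' hP
    (Stage13RParams.ZrUnity.ofHistoryBlind fun _ j ω => finsum_ζ0_ZrOfRecord₁₃ j ω) hUV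

end Numerics

/-! ## §2 ON THE TWO-LETTER STAGE-13 WITNESS FAMILY `θ₁₃(ε₀, ε₂₉) = theta13LiveOfFamily₂ F N ε₀ ε₂₉ (zeta316OfRecord F N (numerics7OfFamily ε₀) 1 1) (RzOfRecord F N) (ZtOfRecord F N)`
(block size `F.L`, window `1∕2`) — the member `n := stage12NumericsOfFamily ε₀` of §1; the witness of record is `(ε₀, ε₂₉) = (1, ⅛)` -/

section Family₂
variable (F : T4Family) (N : ℕ) [NeZero N] (Zr : (p : B12.RunParams) → TkResidualW F N (FluctV N) p.K)
  (Zh : (p : B12.RunParams) → ℕ → (ℕ → Set (Site (F.P p.K) 0)) → (ℕ → Set (Site (F.P p.K) 0)) → TkResidualW F N (FluctV N) p.K)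
  (Phih : (p : B12.RunParams) → ℕ → (ℕ → Set (Site (F.P p.K) 0)) → (ℕ → Set (Site (F.P p.K) 0)) → (ℕ → Plaq (F.P p.K) 0 → ℝ)) {ε₀ ε₂₉ : ℝ}

/-- **N08's SHARE AT ANY MEMBER `θ₁₃(ε₀, ε₂₉)` COSTS `PrintedUV3V N F.L`** (plus `hP : Provisos₁₃CoPH` there and the signs `0 < ε₀`, `0 < ε₂₉`; admissibility is K0a's
`admissible_theta13LiveOfFamily₂`): a world of the member's CoPH datum (`w.γ = 1∕2`, `w.L = F.L`) bound over the [B10]-pinned CoPH view, a ₁₃CCoPH record carrying N08 at every run.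
[cite: Balaban1985UV3, Thm 1 p.257, Thm 2 p.272; Balaban1989LargeFieldII, Thm 1 + (0.1) pp.355–356; Balaban1987RG1, (1.2) p.260, (2.9) p.266 (bookkeeping)] -/
theorem exists_world₁₃CCoPH_b10_main_at_theta13LiveOfFamily₂ (hε : 0 < ε₀) (hε' : 0 < ε₂₉)
    (hP : (⟨⟨theta13LiveOfFamily₂ F N ε₀ ε₂₉ (zeta316OfRecord F N (numerics7OfFamily ε₀) 1 1) (RzOfRecord F N) (ZtOfRecord F N), Zr⟩, Zh, Phih⟩ : Stage13HParams F N).Provisos₁₃CoPH F N)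
    (hUV : PrintedUV3V N F.L) :
    ∃ w : WorldP,
      IsRecordOfRecord₁₃CCoPH F N
          (datumOfRecord₁₃CoPH F N (⟨⟨theta13LiveOfFamily₂ F N ε₀ ε₂₉ (zeta316OfRecord F N (numerics7OfFamily ε₀) 1 1) (RzOfRecord F N) (ZtOfRecord F N), Zr⟩, Zh, Phih⟩ : Stage13HParams F N) hP) w ∧
        w.γ = 1 / 2 ∧ w.L = (F.L : ℝ) ∧
        (∀ P, w.up P = upOfRecord₅C F N
          (((⟨⟨theta13LiveOfFamily₂ F N ε₀ ε₂₉ (zeta316OfRecord F N (numerics7OfFamily ε₀) 1 1) (RzOfRecord F N) (ZtOfRecord F N), Zr⟩, Zh, Phih⟩ : Stage13HParams F N).pinB10 F N).toStage5₁₃CoPH F N) P) ∧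
        ∀ P : B12.RunParams, Dag.B10_main (leavesP w P) :=
  exists_world₁₃CCoPH_b10_main_of_slot _ hP (admissible_theta13LiveOfFamily₂ F N _ _ _ hε hε') (γw := 1 / 2)
    ⟨one_half_pos, (theta13LiveOfFamily₂_γ F N ε₀ ε₂₉ _ _ _).symm.le⟩ hUV

/-- **N08's CONJUNCT OF THE STAGE-13 NODES-∃, WITNESSED AT THE MEMBER `θ₁₃(ε₀, ε₂₉)`, `N = 2`** — from `hP : Provisos₁₃CoPH` there (HYPOTHESIS), `0 < ε₀`, `0 < ε₂₉` and
`PrintedUV3V 2 F.L`; guard (HYPOTHESIS-FREE) and admissibility are K0a's theorems BY NAME.  NOT the stub, NOT a discharge. [cite: Balaban1985UV3, Thm 1 p.257, Thm 2 p.272; Balaban1988Convergent, Thm 1 p.262, (3.16)–(3.22) pp.268–269; Balaban1989LargeFieldI, (0.3)–(0.4) p.176 (bookkeeping)] -/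
theorem exists_guarded_record₁₃CCoPH_b10_main_of_theta13Family₂_provisosCoPH_two (F : T4Family) (Zr : (p : B12.RunParams) → TkResidualW F 2 (FluctV 2) p.K)
    (Zh : (p : B12.RunParams) → ℕ → (ℕ → Set (Site (F.P p.K) 0)) → (ℕ → Set (Site (F.P p.K) 0)) → TkResidualW F 2 (FluctV 2) p.K)
    (Phih : (p : B12.RunParams) → ℕ → (ℕ → Set (Site (F.P p.K) 0)) → (ℕ → Set (Site (F.P p.K) 0)) → (ℕ → Plaq (F.P p.K) 0 → ℝ)) {ε₀ ε₂₉ : ℝ} (hε : 0 < ε₀) (hε' : 0 < ε₂₉)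
    (hP : (⟨⟨theta13LiveOfFamily₂ F 2 ε₀ ε₂₉ (zeta316OfRecord F 2 (numerics7OfFamily ε₀) 1 1) (RzOfRecord F 2) (ZtOfRecord F 2), Zr⟩, Zh, Phih⟩ : Stage13HParams F 2).Provisos₁₃CoPH F 2)
    (hZ : (⟨⟨theta13LiveOfFamily₂ F 2 ε₀ ε₂₉ (zeta316OfRecord F 2 (numerics7OfFamily ε₀) 1 1) (RzOfRecord F 2) (ZtOfRecord F 2), Zr⟩, Zh, Phih⟩ : Stage13HParams F 2).ZhUnity F 2) (hUV : PrintedUV3V 2 F.L) :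
    ∃ (θ : Stage13HParams F 2) (h : θ.Provisos₁₃CoPH F 2) (w : WorldP), (θ.ZhUnity F 2 ∧ θ.SlotsNondegenerate₁₃ F 2) ∧ θ.Admissible F 2 ∧
      IsRecordOfRecord₁₃CCoPH F 2 (datumOfRecord₁₃CoPH F 2 θ h) w ∧ ∀ P : B12.RunParams, Dag.B10_main (leavesP w P) := by
  obtain ⟨w, hR, -, -, -, hN⟩ := exists_world₁₃CCoPH_b10_main_at_theta13LiveOfFamily₂ F 2 Zr Zh Phih hε hε' hP hUV
  exact ⟨_, hP, w, ⟨hZ, slotsNondegenerate₁₃_theta13LiveOfFamily₂_of_hasResiduals F 2 ε₀ ε₂₉⟩,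
    admissible_theta13LiveOfFamily₂ F 2 _ _ _ hε hε', hR, hN⟩

end Family₂

/-! ## §3 THE SUPPLIER CURRENCIES OF THE SLOT AT THE FAMILY'S OWN BLOCK SIZE `F.L` — (u) uniform leaf systems, (r) «relative to (5)», (o) per-run data with a run-uniform
O(1) — on print's `F.L`-runs `runObjects₀T N 𝔗 (Backgrounds.ofPrint N F.L)` at a version `𝔗 : TFamily₃ N F.L` of print's transformations (2) -/

section SupplierNumerics
variable (F : T4Family) (N : ℕ) [NeZero N] (Zr : (p : B12.RunParams) → TkResidualW F N (FluctV N) p.K)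
  (Zh : (p : B12.RunParams) → ℕ → (ℕ → Set (Site (F.P p.K) 0)) → (ℕ → Set (Site (F.P p.K) 0)) → TkResidualW F N (FluctV N) p.K)
  (Phih : (p : B12.RunParams) → ℕ → (ℕ → Set (Site (F.P p.K) 0)) → (ℕ → Set (Site (F.P p.K) 0)) → (ℕ → Plaq (F.P p.K) 0 → ℝ)) {n : Stage12Numerics} {ε₂₉ : ℝ}

/-- **CURRENCY (u) AT THE MEMBER `θ₁₃(n, ε₂₉)` — UNIFORM LEAF SYSTEMS AT BLOCK SIZE `F.L`**: a version `𝔗` of print's transformations on the `F.L`-runs, admissible constants `c`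
and uniform leaf systems on print's run objects give N08's world at the member's datum (dag-n08-a's supplier face `printedUV3V_of_uniformLeafSystems_at` BY NAME into §1).
[cite: Balaban1985UV3, Thm 1 p.257, Thm 2 p.272, Sect. D pp.272–275; Balaban1985Averaging, (10) p.19] -/
theorem exists_world₁₃CCoPH_b10_main_at_theta13LiveOfNumerics_of_uniformLeafSystemsG (hn : n.Pos) (hε' : 0 < ε₂₉)
    (hP : (⟨⟨theta13LiveOfNumerics F N n ε₂₉ (zeta316OfRecord F N n.ν n.τ9.M n.A₁) (RzOfRecord F N) (ZtOfRecord F N), Zr⟩, Zh, Phih⟩ : Stage13HParams F N).Provisos₁₃CoPH F N)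
    (𝔗 : TFamily₃ N F.L) (c : Consts F.L) (hc : c.Adm) (hU : UniformLeafSystemsG N (runObjects₀T N 𝔗 (Backgrounds.ofPrint N F.L)) c) :
    ∃ w : WorldP,
      IsRecordOfRecord₁₃CCoPH F N
          (datumOfRecord₁₃CoPH F N (⟨⟨theta13LiveOfNumerics F N n ε₂₉ (zeta316OfRecord F N n.ν n.τ9.M n.A₁) (RzOfRecord F N) (ZtOfRecord F N), Zr⟩, Zh, Phih⟩ : Stage13HParams F N) hP) w ∧
        w.γ = n.γ ∧ w.L = (F.L : ℝ) ∧
        (∀ P, w.up P = upOfRecord₅C F N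
          (((⟨⟨theta13LiveOfNumerics F N n ε₂₉ (zeta316OfRecord F N n.ν n.τ9.M n.A₁) (RzOfRecord F N) (ZtOfRecord F N), Zr⟩, Zh, Phih⟩ : Stage13HParams F N).pinB10 F N).toStage5₁₃CoPH F N) P) ∧
        ∀ P : B12.RunParams, Dag.B10_main (leavesP w P) :=
  exists_world₁₃CCoPH_b10_main_at_theta13LiveOfNumerics F N Zr Zh Phih hn hε' hP (printedUV3V_of_uniformLeafSystems_at 𝔗 ⟨c, hc, hU⟩)

/-- **CURRENCY (r) AT THE MEMBER — «RELATIVE TO (5)»**: a version `𝔗`, admissible constants `c`, Thm 1's bounds (5) in the compact reading on the `F.L`-runs (LOCATED HYPOTHESIS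
`h5`, print's «O(1) independent of ε, k», p. 257 L1) and per-run representation data `hdata` give N08's world at the member's datum (dag-n08-e's supplier face
`printedUV3V_of_thm1Compact_perRun` BY NAME). [cite: Balaban1985UV3, Thm 1 p.257 (compact reading), Thm 2 p.272, Sect. D pp.272–275] -/
theorem exists_world₁₃CCoPH_b10_main_at_theta13LiveOfNumerics_of_thm1Compact_perRun (hn : n.Pos) (hε' : 0 < ε₂₉)
    (hP : (⟨⟨theta13LiveOfNumerics F N n ε₂₉ (zeta316OfRecord F N n.ν n.τ9.M n.A₁) (RzOfRecord F N) (ZtOfRecord F N), Zr⟩, Zh, Phih⟩ : Stage13HParams F N).Provisos₁₃CoPH F N)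
    (𝔗 : TFamily₃ N F.L) (c : Consts F.L) (hc : c.Adm)
    (h5 : B10.Thm1PrintedCompact (runsAtG N (runObjects₀T N 𝔗 (Backgrounds.ofPrint N F.L)) c))
    (hdata : ∀ S : Family F.L c.eps0, ∃ (C : B10Assembly.Consts) (W : SectB.TowerObjects S.1 (SU N)),
      W.toRunObjects = runObjects₀T N 𝔗 (Backgrounds.ofPrint N F.L) c S.1 ∧ Nonempty (B10Assembly.LeafSystem C W.pin.toTowerRun)) :
    ∃ w : WorldP,
      IsRecordOfRecord₁₃CCoPH F N
          (datumOfRecord₁₃CoPH F N (⟨⟨theta13LiveOfNumerics F N n ε₂₉ (zeta316OfRecord F N n.ν n.τ9.M n.A₁) (RzOfRecord F N) (ZtOfRecord F N), Zr⟩, Zh, Phih⟩ : Stage13HParams F N) hP) w ∧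
        w.γ = n.γ ∧ w.L = (F.L : ℝ) ∧
        (∀ P, w.up P = upOfRecord₅C F N
          (((⟨⟨theta13LiveOfNumerics F N n ε₂₉ (zeta316OfRecord F N n.ν n.τ9.M n.A₁) (RzOfRecord F N) (ZtOfRecord F N), Zr⟩, Zh, Phih⟩ : Stage13HParams F N).pinB10 F N).toStage5₁₃CoPH F N) P) ∧
        ∀ P : B12.RunParams, Dag.B10_main (leavesP w P) :=
  exists_world₁₃CCoPH_b10_main_at_theta13LiveOfNumerics F N Zr Zh Phih hn hε' hP (printedUV3V_of_thm1Compact_perRun N F.L 𝔗 c hc h5 hdata)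

/-- **CURRENCY (o) AT THE MEMBER — PER-RUN DATA WITH A RUN-UNIFORM O(1)**: a version `𝔗`, admissible constants `c`, and per-run representation data on the `F.L`-runs whose
displayed O(1) is bounded by one `O` across the family give N08's world at the member's datum (dag-n08-a's sharpest data currency `printedUV3V_of_perRunUniformO1` BY NAME).
[cite: Balaban1985UV3, Thm 1 p.257 L1, Thm 2 p.272, Sect. D pp.272–274] -/
theorem exists_world₁₃CCoPH_b10_main_at_theta13LiveOfNumerics_of_perRunUniformO1 (hn : n.Pos) (hε' : 0 < ε₂₉)
    (hP : (⟨⟨theta13LiveOfNumerics F N n ε₂₉ (zeta316OfRecord F N n.ν n.τ9.M n.A₁) (RzOfRecord F N) (ZtOfRecord F N), Zr⟩, Zh, Phih⟩ : Stage13HParams F N).Provisos₁₃CoPH F N)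
    (𝔗 : TFamily₃ N F.L) (c : Consts F.L) (hc : c.Adm) (O : ℝ → ℝ → ℝ)
    (h : ∀ S : Family F.L c.eps0, ∃ (C : B10Assembly.Consts) (W : SectB.TowerObjects S.1 (SU N)),
      W.toRunObjects = runObjects₀T N 𝔗 (Backgrounds.ofPrint N F.L) c S.1 ∧ Nonempty (B10Assembly.LeafSystem C W.pin.toTowerRun) ∧
        ∀ gmin gmax : ℝ, 0 < gmin → gmin ≤ gmax → B10Assembly.O1 C gmin gmax ≤ O gmin gmax) :
    ∃ w : WorldP,
      IsRecordOfRecord₁₃CCoPH F N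
          (datumOfRecord₁₃CoPH F N (⟨⟨theta13LiveOfNumerics F N n ε₂₉ (zeta316OfRecord F N n.ν n.τ9.M n.A₁) (RzOfRecord F N) (ZtOfRecord F N), Zr⟩, Zh, Phih⟩ : Stage13HParams F N) hP) w ∧
        w.γ = n.γ ∧ w.L = (F.L : ℝ) ∧
        (∀ P, w.up P = upOfRecord₅C F N
          (((⟨⟨theta13LiveOfNumerics F N n ε₂₉ (zeta316OfRecord F N n.ν n.τ9.M n.A₁) (RzOfRecord F N) (ZtOfRecord F N), Zr⟩, Zh, Phih⟩ : Stage13HParams F N).pinB10 F N).toStage5₁₃CoPH F N) P) ∧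
        ∀ P : B12.RunParams, Dag.B10_main (leavesP w P) :=
  exists_world₁₃CCoPH_b10_main_at_theta13LiveOfNumerics F N Zr Zh Phih hn hε' hP (printedUV3V_of_perRunUniformO1 N F.L 𝔗 c hc O h)

end SupplierNumerics

section SupplierGuarded
variable (F : T4Family) (Zr : (p : B12.RunParams) → TkResidualW F 2 (FluctV 2) p.K)
  (Zh : (p : B12.RunParams) → ℕ → (ℕ → Set (Site (F.P p.K) 0)) → (ℕ → Set (Site (F.P p.K) 0)) → TkResidualW F 2 (FluctV 2) p.K)
  (Phih : (p : B12.RunParams) → ℕ → (ℕ → Set (Site (F.P p.K) 0)) → (ℕ → Set (Site (F.P p.K) 0)) → (ℕ → Plaq (F.P p.K) 0 → ℝ)) {n : Stage12Numerics} {ε₂₉ : ℝ}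

/-- **CURRENCY (u) INTO N08's CONJUNCT OF A CORE-KEYED ₁₃ NODES-∃ AT THE MEMBER `θL F n ε₂₉`, `N = 2`**: the signs, the Core provisos at the member (`hP`, HYPOTHESIS, opaque),
and — in place of `PrintedUV3V 2 F.L` — a version `𝔗 : TFamily₃ 2 F.L` of print's transformations with admissible constants and UNIFORM LEAF SYSTEMS on print's `F.L`-run
objects for SU(2) (dag-n08-a's supplier face BY NAME into §1).  What a d = 3 lane END theorem must deliver for N08 AT THE RECORD, in the uniform currency. [cite: Balaban1985UV3, Thm 1 p.257, Thm 2 p.272, Sect. D pp.272–275; Balaban1988Convergent, (3.16)–(3.22) pp.268–269 (bookkeeping)] -/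
theorem exists_guarded_record₁₃CCoPH_b10_main_of_theta13Numerics_provisosCoPH_two_of_uniformLeafSystemsG (hn : n.Pos) (hε' : 0 < ε₂₉)
    (hP : (⟨⟨theta13LiveOfNumerics F 2 n ε₂₉ (zeta316OfRecord F 2 n.ν n.τ9.M n.A₁) (RzOfRecord F 2) (ZtOfRecord F 2), Zr⟩, Zh, Phih⟩ : Stage13HParams F 2).Provisos₁₃CoPH F 2)
    (hZ : (⟨⟨theta13LiveOfNumerics F 2 n ε₂₉ (zeta316OfRecord F 2 n.ν n.τ9.M n.A₁) (RzOfRecord F 2) (ZtOfRecord F 2), Zr⟩, Zh, Phih⟩ : Stage13HParams F 2).ZhUnity F 2) (𝔗 : TFamily₃ 2 F.L) (c : Consts F.L) (hc : c.Adm) (hU : UniformLeafSystemsG 2 (runObjects₀T 2 𝔗 (Backgrounds.ofPrint 2 F.L)) c) :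
    ∃ (θ : Stage13HParams F 2) (h : θ.Provisos₁₃CoPH F 2) (w : WorldP), (θ.ZhUnity F 2 ∧ θ.SlotsNondegenerate₁₃ F 2) ∧ θ.Admissible F 2 ∧
      IsRecordOfRecord₁₃CCoPH F 2 (datumOfRecord₁₃CoPH F 2 θ h) w ∧ ∀ P : B12.RunParams, Dag.B10_main (leavesP w P) :=
  exists_guarded_record₁₃CCoPH_b10_main_of_theta13Numerics_provisosCoPH_two F Zr Zh Phih hn hε' hP hZ (printedUV3V_of_uniformLeafSystems_at 𝔗 ⟨c, hc, hU⟩)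

/-- **CURRENCY (r) INTO N08's CONJUNCT AT THE MEMBER, `N = 2`** — the signs, the Core provisos at the member, a version `𝔗`, admissible `c`, Thm 1's bounds (5) in the compact
reading on the `F.L`-runs for SU(2) (LOCATED HYPOTHESIS `h5`) and per-run representation data `hdata` (dag-n08-e's currency BY NAME: what the END theorem must add to its per-run
towers is exactly `h5`). [cite: Balaban1985UV3, Thm 1 p.257 (compact reading), Thm 2 p.272, Sect. D pp.272–275; Balaban1988Convergent, (3.16)–(3.22) pp.268–269 (bookkeeping)] -/
theorem exists_guarded_record₁₃CCoPH_b10_main_of_theta13Numerics_provisosCoPH_two_of_thm1Compact_perRun (hn : n.Pos) (hε' : 0 < ε₂₉)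
    (hP : (⟨⟨theta13LiveOfNumerics F 2 n ε₂₉ (zeta316OfRecord F 2 n.ν n.τ9.M n.A₁) (RzOfRecord F 2) (ZtOfRecord F 2), Zr⟩, Zh, Phih⟩ : Stage13HParams F 2).Provisos₁₃CoPH F 2)
    (hZ : (⟨⟨theta13LiveOfNumerics F 2 n ε₂₉ (zeta316OfRecord F 2 n.ν n.τ9.M n.A₁) (RzOfRecord F 2) (ZtOfRecord F 2), Zr⟩, Zh, Phih⟩ : Stage13HParams F 2).ZhUnity F 2) (𝔗 : TFamily₃ 2 F.L) (c : Consts F.L) (hc : c.Adm)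
    (h5 : B10.Thm1PrintedCompact (runsAtG 2 (runObjects₀T 2 𝔗 (Backgrounds.ofPrint 2 F.L)) c))
    (hdata : ∀ S : Family F.L c.eps0, ∃ (C : B10Assembly.Consts) (W : SectB.TowerObjects S.1 (SU 2)),
      W.toRunObjects = runObjects₀T 2 𝔗 (Backgrounds.ofPrint 2 F.L) c S.1 ∧ Nonempty (B10Assembly.LeafSystem C W.pin.toTowerRun)) :
    ∃ (θ : Stage13HParams F 2) (h : θ.Provisos₁₃CoPH F 2) (w : WorldP), (θ.ZhUnity F 2 ∧ θ.SlotsNondegenerate₁₃ F 2) ∧ θ.Admissible F 2 ∧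
      IsRecordOfRecord₁₃CCoPH F 2 (datumOfRecord₁₃CoPH F 2 θ h) w ∧ ∀ P : B12.RunParams, Dag.B10_main (leavesP w P) :=
  exists_guarded_record₁₃CCoPH_b10_main_of_theta13Numerics_provisosCoPH_two F Zr Zh Phih hn hε' hP hZ (printedUV3V_of_thm1Compact_perRun 2 F.L 𝔗 c hc h5 hdata)

/-- **CURRENCY (o) INTO N08's CONJUNCT AT THE MEMBER, `N = 2`** — the signs, the Core provisos at the member, a version `𝔗`, admissible `c`, and per-run representation data on
the `F.L`-runs whose displayed O(1) is bounded by one `O` across the family (dag-n08-a's sharpest data currency BY NAME). [cite: Balaban1985UV3, Thm 1 p.257 L1, Thm 2 p.272, Sect. D pp.272–274; Balaban1988Convergent, (3.16)–(3.22) pp.268–269 (bookkeeping)] -/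
theorem exists_guarded_record₁₃CCoPH_b10_main_of_theta13Numerics_provisosCoPH_two_of_perRunUniformO1 (hn : n.Pos) (hε' : 0 < ε₂₉)
    (hP : (⟨⟨theta13LiveOfNumerics F 2 n ε₂₉ (zeta316OfRecord F 2 n.ν n.τ9.M n.A₁) (RzOfRecord F 2) (ZtOfRecord F 2), Zr⟩, Zh, Phih⟩ : Stage13HParams F 2).Provisos₁₃CoPH F 2)
    (hZ : (⟨⟨theta13LiveOfNumerics F 2 n ε₂₉ (zeta316OfRecord F 2 n.ν n.τ9.M n.A₁) (RzOfRecord F 2) (ZtOfRecord F 2), Zr⟩, Zh, Phih⟩ : Stage13HParams F 2).ZhUnity F 2) (𝔗 : TFamily₃ 2 F.L) (c : Consts F.L) (hc : c.Adm) (O : ℝ → ℝ → ℝ)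
    (h : ∀ S : Family F.L c.eps0, ∃ (C : B10Assembly.Consts) (W : SectB.TowerObjects S.1 (SU 2)),
      W.toRunObjects = runObjects₀T 2 𝔗 (Backgrounds.ofPrint 2 F.L) c S.1 ∧ Nonempty (B10Assembly.LeafSystem C W.pin.toTowerRun) ∧
        ∀ gmin gmax : ℝ, 0 < gmin → gmin ≤ gmax → B10Assembly.O1 C gmin gmax ≤ O gmin gmax) :
    ∃ (θ : Stage13HParams F 2) (h : θ.Provisos₁₃CoPH F 2) (w : WorldP), (θ.ZhUnity F 2 ∧ θ.SlotsNondegenerate₁₃ F 2) ∧ θ.Admissible F 2 ∧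
      IsRecordOfRecord₁₃CCoPH F 2 (datumOfRecord₁₃CoPH F 2 θ h) w ∧ ∀ P : B12.RunParams, Dag.B10_main (leavesP w P) :=
  exists_guarded_record₁₃CCoPH_b10_main_of_theta13Numerics_provisosCoPH_two F Zr Zh Phih hn hε' hP hZ (printedUV3V_of_perRunUniformO1 2 F.L 𝔗 c hc O h)

end SupplierGuarded

end Summit.QuantumFields.YangMills.BalabanUVNodes.N08AtRecord13CoPHFamily

end
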